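import Summits.ValiantsHypothesis.ValiantsHypothesis.Theorems.GrenetZeonHessianRankCodimTwoLatinFrobenius
import HarnessLib

/-!
# Crux `GrenetZeon.HessianRankCodimTwo` (stmt-ValiantsHypothesis-8061), line `good_plane` v2,
# stub `stub_goodPlaneThreePrime` — Theorem P, PART A(ii): the block-value congruence
# `Ψ̃_{IJ} = x_d^{p-2} P_d^p`, homogeneity, base change, evaluated forms

Continuation of `…LatinFrobenius.lean` (vocabulary in `…LatinFrobeniusDefs.lean`):

* **congruence 2 of Theorem P** (`coeff_rowForm_pow_mul_prime`, `latinPsi_eq`): in characteristic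
  `p`, `[y^{(p,p,p)-2e_J}] ℓ_I^{p-2} ℓ_{I+1}^p ℓ_{I+2}^p = x_d^{p-2} (x_d² + x_{d+1}x_{d+2})^p`,
  `d = J - I` — base-`p` digits: `y_J^{p-2}` must come from `ℓ_I^{p-2}` and `y_{J+1}^p, y_{J+2}^p`
  from the two Frobenius factors, in either order;
* the fibre-cardinality form of the colouring bridge (`coeff_prod_rowForm_card`) and the reshaping
  lemmas `prod_rowForm_pow_eq`, `rowForm_pow_mul_eq`, `prod_univ_erase_fin_three` used by the
  fibre count (PART B, val-width-8061-p4);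
* homogeneity `latinPhi_isHomogeneous` (degree `3p`), `latinPsi_isHomogeneous` (degree `3p-2`) and
  base change `map_latinPhi`, `map_latinPsi` — the hypotheses of the reduction modulo `p`
  (`…ReduceModP.lean`, `exists_charP_commonZero`);
* the congruences restated for the named polynomials (`latinPhi_eq_cubicF_pow`, `latinPsi_eq`) and
  EVALUATED over `ℤ` in a ring of characteristic `p` (`aeval_latinPhi_int`, `aeval_latinPsi_int`) —
  the form consumed by the assembly (PART C, val-width-8061-p2).

VP ≠ VNP is not moved: the crux only feeds the constant-factor bound `TwoDimCoefficients`.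
-/

noncomputable section

open MvPolynomial Finset

-- single-conjunct layout `Summits/ValiantsHypothesis/ValiantsHypothesis`: duplicated namespace by design
set_option linter.dupNamespace false

namespace Summit.ValiantsHypothesis.ValiantsHypothesis.Theorems.GrenetZeonHessianRankCodimTwo

variable {R : Type*} [CommRing R]

section Frobenius

variable (p : ℕ) [hp : Fact p.Prime] [CharP R p]

/-! ### The block-value generating function: `ℓ_I^{p-2} ℓ_{I+1}^p ℓ_{I+2}^p` -/

/-- Product of two Frobenius row forms as a sum of monomials in `y^p`. [folklore] -/
theorem rowForm_pow_prime_mul (I₁ I₂ : Fin 3) :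
    rowForm R I₁ ^ p * rowForm R I₂ ^ p =
      ∑ J₁ : Fin 3, ∑ J₂ : Fin 3, monomial (p • (Finsupp.single J₁ 1 + Finsupp.single J₂ 1))
        (X (J₁ - I₁) ^ p * X (J₂ - I₂) ^ p) := by
  rw [rowForm_pow_prime, rowForm_pow_prime, Finset.sum_mul_sum]
  refine Finset.sum_congr rfl fun J₁ _ => Finset.sum_congr rfl fun J₂ _ => ?_
  rw [C_mul_X_pow_eq_monomial, C_mul_X_pow_eq_monomial, monomial_mul, smul_add,
    Finsupp.smul_single, Finsupp.smul_single, smul_eq_mul, mul_one]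

omit hp [CharP R p] in
/-- Base-`p` digits of the block-value exponent `(p,p,p) - 2e_J`:
low digit `(p-2) e_J`, high digits `e_{J+1} + e_{J+2}`. [folklore] -/
theorem sum_single_ite_eq (J : Fin 3) :
    (∑ K : Fin 3, Finsupp.single K (if K = J then p - 2 else p)) =
      Finsupp.single J (p - 2) + p • (Finsupp.single (J + 1) 1 + Finsupp.single (J + 2) 1) := by
  ext K
  have key : ∀ a b : Fin 3, a = b + (a - b) := by decide
  obtain ⟨t, rfl⟩ : ∃ t, K = J + t := ⟨K - J, key K J⟩
  simp only [Finsupp.finsetSum_apply, Finsupp.single_apply, Finsupp.coe_add, Finsupp.coe_smul,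
    Pi.add_apply, Pi.smul_apply, smul_eq_mul, Finset.sum_ite_eq', Finset.mem_univ, if_true]
  fin_cases t <;> simp

omit hp [CharP R p] in
/-- Two-element multisets: `e_a + e_b = e_c + e_d` iff `(a,b) = (c,d)` or `(a,b) = (d,c)`. [folklore] -/
theorem single_add_single_eq_iff {α : Type*} [DecidableEq α] (a b c d : α) :
    (Finsupp.single a (1 : ℕ) + Finsupp.single b 1 = Finsupp.single c 1 + Finsupp.single d 1) ↔
      (a = c ∧ b = d) ∨ (a = d ∧ b = c) := by
  constructor
  · intro h
    have hval : ∀ x, ((if a = x then 1 else 0) + (if b = x then 1 else 0) : ℕ) =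
        (if c = x then 1 else 0) + (if d = x then 1 else 0) := fun x => by
      have := congrArg (fun f : α →₀ ℕ => f x) h
      simpa [Finsupp.single_apply] using this
    by_cases hac : a = c
    · refine Or.inl ⟨hac, ?_⟩
      have hb := hval b
      rw [hac, if_pos rfl] at hb
      by_contra hbd
      rw [if_neg (Ne.symm hbd)] at hb
      omega
    · have ha := hval a
      rw [if_pos rfl, if_neg (Ne.symm hac)] at ha
      have had : d = a := by
        by_contra had
        rw [if_neg had] at ha
        split_ifs at ha <;> omega
      refine Or.inr ⟨had.symm, ?_⟩
      have hb := hval b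
      rw [had, if_pos rfl] at hb
      by_contra hbc
      rw [if_neg (Ne.symm hbc)] at hb
      omega
  · rintro (⟨rfl, rfl⟩ | ⟨rfl, rfl⟩)
    · rfl
    · exact add_comm _ _

omit hp [CharP R p] in
/-- Double sums over `Fin 3` re-indexed by a translation. [folklore] -/
theorem sum_sum_eq_sum_sum_add {M : Type*} [AddCommMonoid M] (J : Fin 3) (f : Fin 3 → Fin 3 → M) :
    (∑ J₁, ∑ J₂, f J₁ J₂) = ∑ u, ∑ v, f (J + u) (J + v) := by
  rw [← Equiv.sum_comp (Equiv.addLeft J)]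
  refine Finset.sum_congr rfl fun u _ => ?_
  rw [← Equiv.sum_comp (Equiv.addLeft J)]
  rfl

/-- **Frobenius congruence for the block-value generating function (Theorem P,
`η̃_{IJ} ≡ x_{J-I}^{p-2} P_{J-I}^p`).**  In characteristic `p`, the coefficient of
`y^{(p,p,p) - 2e_J}` in `ℓ_I^{p-2} · ℓ_{I+1}^p · ℓ_{I+2}^p` is `x_d^{p-2} (x_d² + x_{d+1}x_{d+2})^p`,
`d = J - I`: the only base-`p` digit pattern reaching the exponent takes `y_J^{p-2}` from `ℓ_I^{p-2}`
and `y_{J+1}^p, y_{J+2}^p` from the two Frobenius factors, in either order. [folklore] -/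
theorem coeff_rowForm_pow_mul_prime (I J : Fin 3) :
    coeff (∑ K : Fin 3, Finsupp.single K (if K = J then p - 2 else p))
      (rowForm R I ^ (p - 2) * (rowForm R (I + 1) ^ p * rowForm R (I + 2) ^ p)) =
      X (J - I) ^ (p - 2) * quadP R (J - I) ^ p := by
  classical
  have hp2 : p - 2 < p := by have := hp.out.two_le; omega
  rw [sum_single_ite_eq, rowForm_pow_prime_mul, Finset.mul_sum, coeff_sum]
  simp_rw [Finset.mul_sum, coeff_sum]
  have hdig : ∀ J₁ J₂ : Fin 3,
      coeff (Finsupp.single J (p - 2) + p • (Finsupp.single (J + 1) 1 + Finsupp.single (J + 2) 1))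
        (rowForm R I ^ (p - 2) * monomial (p • (Finsupp.single J₁ 1 + Finsupp.single J₂ 1))
          (X (J₁ - (I + 1)) ^ p * X (J₂ - (I + 2)) ^ p)) =
      if (J₁ = J + 1 ∧ J₂ = J + 2) ∨ (J₁ = J + 2 ∧ J₂ = J + 1) then
        X (J - I) ^ (p - 2) * (X (J₁ - (I + 1)) ^ p * X (J₂ - (I + 2)) ^ p) else 0 := by
    intro J₁ J₂
    rw [coeff_add_smul_mul_monomial p hp.out.pos _
      (fun m hm K => lt_of_le_of_lt (apply_le_of_mem_support_rowForm_pow I (p - 2) hm K) hp2) _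
      (fun K => by rw [Finsupp.single_apply]; split_ifs <;> omega), coeff_single_rowForm_pow]
    exact if_congr (single_add_single_eq_iff _ _ _ _) rfl rfl
  simp_rw [hdig]
  rw [sum_sum_eq_sum_sum_add J]
  simp only [add_right_inj, Fin.sum_univ_three, Fin.isValue, Fin.reduceEq, and_true,
    and_false, or_self, or_false, false_or, if_true, if_false, zero_add, add_zero]
  have h1 : J + 1 - (I + 1) = J - I := by
    have key : ∀ a b : Fin 3, a + 1 - (b + 1) = a - b := by decide
    exact key J I
  have h2 : J + 2 - (I + 2) = J - I := by
    have key : ∀ a b : Fin 3, a + 2 - (b + 2) = a - b := by decide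
    exact key J I
  have h3 : J + 2 - (I + 1) = J - I + 1 := by
    have key : ∀ a b : Fin 3, a + 2 - (b + 1) = a - b + 1 := by decide
    exact key J I
  have h4 : J + 1 - (I + 2) = J - I + 2 := by
    have key : ∀ a b : Fin 3, a + 1 - (b + 2) = a - b + 2 := by decide
    exact key J I
  rw [h1, h2, h3, h4, quadP, add_pow_char, mul_pow, ← pow_mul]
  ring

end Frobenius

/-! ### Colour multiplicities as fibre cardinalities (interface with the fibre count, PART B) -/

/-- The multiplicity vector `Σ_r e_{g r}` evaluated at a colour `K` is the size of the fibre
`g⁻¹(K)`. [folklore] -/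
theorem sum_single_one_apply {ι : Type*} [Fintype ι] (g : ι → Fin 3) (K : Fin 3) :
    (∑ r, Finsupp.single (g r) (1 : ℕ)) K = (univ.filter fun r => g r = K).card := by
  classical
  rw [Finsupp.finsetSum_apply, Finset.card_filter]
  refine Finset.sum_congr rfl fun r _ => ?_
  rw [Finsupp.single_apply]

/-- **Colouring / table bridge, fibre-cardinality form.**  The coefficient of `y^ν` in
`Π_r ℓ_{blk r}` is the sum of `Π_r x_{g r - blk r}` over the colourings `g : ι → Fin 3` whose fibres
have the prescribed sizes `|g⁻¹(K)| = ν K`. [folklore] -/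
theorem coeff_prod_rowForm_card {ι : Type*} [Fintype ι] [DecidableEq ι] (blk : ι → Fin 3)
    (ν : Fin 3 →₀ ℕ) :
    coeff ν (∏ r, rowForm R (blk r)) =
      ∑ g ∈ univ.filter (fun g : ι → Fin 3 => ∀ K, (univ.filter fun r => g r = K).card = ν K),
        ∏ r, X (g r - blk r) := by
  rw [coeff_prod_rowForm]
  refine Finset.sum_congr (Finset.filter_congr fun g _ => ?_) fun _ _ => rfl
  rw [Finsupp.ext_iff]
  exact forall_congr' fun K => by rw [sum_single_one_apply]

omit [CommRing R] in
/-- Products over `Fin 3` with one index removed. [folklore] -/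
theorem prod_univ_erase_fin_three {M : Type*} [CommMonoid M] (I : Fin 3) (f : Fin 3 → M) :
    (∏ I' ∈ univ.erase I, f I') = f (I + 1) * f (I + 2) := by
  have key : ∀ I : Fin 3, (univ.erase I : Finset (Fin 3)) = {I + 1, I + 2} := by decide
  have hne : I + 1 ≠ I + 2 := by
    have : ∀ I : Fin 3, I + 1 ≠ I + 2 := by decide
    exact this I
  rw [key, Finset.prod_pair hne]

/-! ### Homogeneity (for the reduction modulo `p`) -/

/-- Coefficients of `Π_r ℓ_{blk r}` are homogeneous of degree `|ι|` in `x`. [folklore] -/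
theorem isHomogeneous_coeff_prod_rowForm {ι : Type*} [Fintype ι] (blk : ι → Fin 3)
    (ν : Fin 3 →₀ ℕ) : (coeff ν (∏ r, rowForm R (blk r))).IsHomogeneous (Fintype.card ι) := by
  classical
  rw [coeff_prod_rowForm]
  refine IsHomogeneous.sum _ _ _ fun g _ => ?_
  have h := IsHomogeneous.prod Finset.univ (fun r => (X (g r - blk r) : MvPolynomial (Fin 3) R))
    (fun _ => 1) fun r _ => isHomogeneous_X _ _
  simpa using h

/-- `ℓ_0^p ℓ_1^p ℓ_2^p` as a product of `3p` row forms. [folklore] -/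
theorem prod_rowForm_pow_eq (p : ℕ) :
    (∏ I, rowForm R I ^ p) = ∏ x : Fin 3 × Fin p, rowForm R x.1 := by
  rw [Fintype.prod_prod_type]
  refine Finset.prod_congr rfl fun I _ => ?_
  show rowForm R I ^ p = ∏ _y : Fin p, rowForm R I
  rw [Finset.prod_const, Finset.card_univ, Fintype.card_fin]

/-- `ℓ_I^{p-2} ℓ_{I+1}^p ℓ_{I+2}^p` as a product of `3p - 2` row forms. [folklore] -/
theorem rowForm_pow_mul_eq (p : ℕ) (I : Fin 3) :
    rowForm R I ^ (p - 2) * (rowForm R (I + 1) ^ p * rowForm R (I + 2) ^ p) =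
      ∏ x : Fin (p - 2) ⊕ (Fin p ⊕ Fin p),
        rowForm R (Sum.elim (fun _ => I) (Sum.elim (fun _ => I + 1) (fun _ => I + 2)) x) := by
  rw [Fintype.prod_sum_type, Fintype.prod_sum_type]
  simp only [Sum.elim_inl, Sum.elim_inr, Finset.prod_const, Finset.card_univ, Fintype.card_fin]

/-- `Φ̃_p` is homogeneous of degree `3p`. [folklore] -/
theorem latinPhi_isHomogeneous (p : ℕ) : (latinPhi R p).IsHomogeneous (3 * p) := by
  have h := isHomogeneous_coeff_prod_rowForm (R := R) (fun x : Fin 3 × Fin p => x.1)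
    (∑ K : Fin 3, Finsupp.single K p)
  rw [← prod_rowForm_pow_eq, Fintype.card_prod, Fintype.card_fin, Fintype.card_fin] at h
  exact h

/-- `Ψ̃_{IJ}` is homogeneous of degree `3p - 2` (`p ≥ 2`). [folklore] -/
theorem latinPsi_isHomogeneous (p : ℕ) (hp : 2 ≤ p) (I J : Fin 3) :
    (latinPsi R p I J).IsHomogeneous (3 * p - 2) := by
  have h := isHomogeneous_coeff_prod_rowForm (R := R)
    (Sum.elim (fun _ : Fin (p - 2) => I) (Sum.elim (fun _ : Fin p => I + 1) (fun _ : Fin p => I + 2)))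
    (∑ K : Fin 3, Finsupp.single K (if K = J then p - 2 else p))
  rw [← rowForm_pow_mul_eq, Fintype.card_sum, Fintype.card_sum, Fintype.card_fin,
    Fintype.card_fin, show p - 2 + (p + p) = 3 * p - 2 by omega] at h
  exact h

/-! ### Change of coefficient ring -/

section Map

variable {S : Type*} [CommRing S] (f : R →+* S)

/-- Row forms are defined over `ℤ`: they commute with any change of coefficients. [folklore] -/
theorem map_rowForm (I : Fin 3) :
    MvPolynomial.map (MvPolynomial.map f) (rowForm R I) = rowForm S I := by
  simp [rowForm_def, map_X, map_C]

/-- `F` commutes with change of coefficients. [folklore] -/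
theorem map_cubicF : MvPolynomial.map f (cubicF R) = cubicF S := by
  simp [cubicF, map_X]

/-- `P_d` commutes with change of coefficients. [folklore] -/
theorem map_quadP (d : Fin 3) : MvPolynomial.map f (quadP R d) = quadP S d := by
  simp [quadP, map_X]

/-- `Φ̃_p` commutes with change of coefficients. [folklore] -/
theorem map_latinPhi (p : ℕ) : MvPolynomial.map f (latinPhi R p) = latinPhi S p := by
  rw [latinPhi, latinPhi, ← coeff_map, map_prod]
  simp_rw [map_pow, map_rowForm]

/-- `Ψ̃_{IJ}` commutes with change of coefficients. [folklore] -/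
theorem map_latinPsi (p : ℕ) (I J : Fin 3) :
    MvPolynomial.map f (latinPsi R p I J) = latinPsi S p I J := by
  rw [latinPsi, latinPsi, ← coeff_map, map_mul, map_mul, map_pow, map_pow, map_pow,
    map_rowForm, map_rowForm, map_rowForm]

end Map

/-! ### The congruences, and their evaluated forms in characteristic `p` -/

section CharP

variable (p : ℕ) [hp : Fact p.Prime] [CharP R p]

/-- **Theorem P, congruence 1:** `Φ̃_p = F^p` over any commutative ring of characteristic `p`.
[folklore] -/
theorem latinPhi_eq_cubicF_pow : latinPhi R p = cubicF R ^ p :=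
  coeff_prod_rowForm_pow_prime p

/-- **Theorem P, congruence 2:** `Ψ̃_{IJ} = x_d^{p-2} · P_d^p`, `d = J - I`, over any commutative
ring of characteristic `p`. [folklore] -/
theorem latinPsi_eq (I J : Fin 3) :
    latinPsi R p I J = X (J - I) ^ (p - 2) * quadP R (J - I) ^ p :=
  coeff_rowForm_pow_mul_prime p I J

end CharP

section Eval

variable (p : ℕ) [hp : Fact p.Prime] {L : Type*} [CommRing L] [CharP L p]

/-- **Evaluated congruence 1.**  For `w` in a commutative ring of characteristic `p`, the INTEGER
polynomial `Φ̃_p` evaluates to `(w_0³ + w_1³ + w_2³ + 3w_0w_1w_2)^p`.  (This is the form consumed by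
the reduction modulo `p`, `exists_charP_commonZero`.) [folklore] -/
theorem aeval_latinPhi_int (w : Fin 3 → L) :
    aeval w (latinPhi ℤ p) = (w 0 ^ 3 + w 1 ^ 3 + w 2 ^ 3 + 3 * (w 0 * w 1 * w 2)) ^ p := by
  rw [MvPolynomial.aeval_def, ← MvPolynomial.eval_map, algebraMap_int_eq, map_latinPhi,
    latinPhi_eq_cubicF_pow, map_pow]
  simp [cubicF]

/-- **Evaluated congruence 2.**  For `w` in a commutative ring of characteristic `p`, the INTEGER
polynomial `Ψ̃_{IJ}` evaluates to `w_d^{p-2} (w_d² + w_{d+1} w_{d+2})^p`, `d = J - I`. [folklore] -/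
theorem aeval_latinPsi_int (w : Fin 3 → L) (I J : Fin 3) :
    aeval w (latinPsi ℤ p I J) =
      w (J - I) ^ (p - 2) * (w (J - I) ^ 2 + w (J - I + 1) * w (J - I + 2)) ^ p := by
  rw [MvPolynomial.aeval_def, ← MvPolynomial.eval_map, algebraMap_int_eq, map_latinPsi,
    latinPsi_eq, map_mul, map_pow, map_pow]
  simp [quadP]

/-- In a domain of characteristic `p`, a zero of the integer polynomial `Φ̃_p` is a zero of `F`.
[folklore] -/
theorem cubic_eq_zero_of_aeval_latinPhi_int [IsDomain L] (w : Fin 3 → L)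
    (h : aeval w (latinPhi ℤ p) = 0) :
    w 0 ^ 3 + w 1 ^ 3 + w 2 ^ 3 + 3 * (w 0 * w 1 * w 2) = 0 := by
  rw [aeval_latinPhi_int] at h
  exact (pow_eq_zero_iff hp.out.ne_zero).mp h

/-- In a domain of characteristic `p ≥ 3`, a zero of the integer polynomial `Ψ̃_{IJ}` satisfies
`w_d = 0` or `P_d(w) = 0`, `d = J - I`. [folklore] -/
theorem eq_zero_or_quad_eq_zero_of_aeval_latinPsi_int [IsDomain L] (hp3 : 3 ≤ p)
    (w : Fin 3 → L) (I J : Fin 3)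
    (h : aeval w (latinPsi ℤ p I J) = 0) :
    w (J - I) = 0 ∨ w (J - I) ^ 2 + w (J - I + 1) * w (J - I + 2) = 0 := by
  rw [aeval_latinPsi_int, mul_eq_zero] at h
  rcases h with h | h
  · exact Or.inl ((pow_eq_zero_iff (by omega)).mp h)
  · exact Or.inr ((pow_eq_zero_iff hp.out.ne_zero).mp h)

end Eval

end Summit.ValiantsHypothesis.ValiantsHypothesis.Theorems.GrenetZeonHessianRankCodimTwo
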